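import Summits.QuantumFields.BalabanUV.Beta.EriceRemainderEnclosureHistoryAutonomyComparisonLoadBudgetWindow

/-!
# EriceRemainderEnclosureHistoryAutonomyComparisonTowerChainSix — (E65i) THE WINDOW BUDGET CLOSES THE DUAL CHAIN ON TOWERS OF RATIO `≥ 6`: as (E65g), but the
# budget is read with the TELESCOPED window weights `S_{s,k} ≥ 2√s(√(s+k+1) − √(s+1))` (from `1∕√m ≥ 2(√(m+1) − √m)`, §1) instead of `k√(s∕(s+k))`: the
# transported young pressure is then at most `(13∕15)(1∕2 − 7x∕10)` (was `21∕20`) and the cubic `step` inequality closes at `s = √r ≤ 49∕120`, i.e. ratio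
# `6` (margin `0.10`; two `nlinarith` cases).  Hypothesis = the window budget of (E65a) at the scales `j = k ∈ A` exactly as (E65b)∕(E65f) offer it.  With
# (E65f): towers of pairwise ratio `≥ 6`, ANY height, ANY sizes and Markov weight compare ((E65j); (E65h): `10`; (E64h): `14`)

Cell `pub-balaban`, β-function sub-cell, BINDER row D4 «RemainderConst leaves for Bałaban's split» (`HOME/BINDER-OWNERS.md`; owner lineage `b2b-balaban-beta-an4`;
this file by co-owner #2 lineage `b2b-balaban-beta-d4-p2`, generation 58), β-FLOW TEAM duty (1), FREEZE (0) honoured (def-free; Mathlib + (E65a)'s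
`mul_sqrt_le_readWindow` ∕ `readWindow_nonneg` BY NAME).

HONEST FRAMING (page 1, verbatim and binding).  *"Discharging BetaPertH makes Bałaban's UV stability UNCONDITIONAL — a real constructive-QFT result; it is
NOT the continuum limit and NOT the Clay problem."*  THIS FILE DISCHARGES NOTHING OF THE KIND.  A lemma about finitely many non-negative reals; its use is
through (E65f), whose hypotheses are those of a census, not facts; nothing of Bałaban's is asserted.  Row D4 class UNCHANGED (critical-path width 0; instance
0∕1; D4 DISCHARGE NO DATE).  HONEST DEPENDENCY: continuum YM on T⁴ ⇐ BetaPertH ∧ nine spine estimates (0/9 proved); BetaPertH ⇐ (D1) ∧ (D4) ∧ CAP+tail;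
G-an2-4 gates asym, D1 and NE2/3/4.

THE POINT (census sense (α); the COMPARISON column, conjecture (E58′), route (C″)).  See (E65g).  The only change is the currency conversion between the budget's
pressure and the chain's: for `s ≤ k⁻ < k`, `S_{s,k}∕k ≥ 2√s∕(√(k⁻+k+1) + √(k⁻+1))`, so `Σ_{s<k} x_sS_{s,k}∕k ≥ ρ·Z_{k⁻}` with `ρ = 2√k⁻∕(√(k⁻+k+1) + √(k⁻+1))`,
and `√(k⁻∕k)∕ρ = (√(k⁻+k+1) + √(k⁻+1))∕(2√k) ≤ 13∕15` as soon as `6k⁻ ≤ k` (`√(k⁻+k+1) ≤ (52∕45)√k`, `√(k⁻+1) ≤ (26∕45)√k`).  Numerically (README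
`stepcheck4.py`) the telescoped weight closes ratio `6` with margin `0.10(x+u)` and ratio `5` only for large ages; ratios `≤ 4` need the exact two-dimensional
region.  NOT CLAIMED: ratios below `6`; anything printed.

WHAT IS PROVED ([folklore]; 0 `def`, 0 sorry).  §1 `two_mul_sub_sqrt_le_inv_sqrt`, **`readWindow_ge_telescope`**, `step_poly_low`, `step_poly_high`, `step_poly`,
`cond_poly`.  §2 **`dual_chain_of_tower_six`**.
-/
noncomputable section
open Finset

namespace Summit.QuantumFields.BalabanUV.Beta.EriceRemainderEnclosureHistoryAutonomyComparisonTowerChainSix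

open Summit.QuantumFields.BalabanUV.Beta.EriceRemainderEnclosureHistoryAutonomyComparisonLoadBudgetWindow (mul_sqrt_le_readWindow readWindow_nonneg)

/-! ## §1 The telescoped window weight and the two-variable polynomial inequalities -/

/-- `2(√(m+1) − √m) ≤ 1∕√m` for `m > 0`. [folklore] -/
theorem two_mul_sub_sqrt_le_inv_sqrt {m : ℝ} (hm : 0 < m) : 2 * (Real.sqrt (m + 1) - Real.sqrt m) ≤ 1 / Real.sqrt m := by
  have hsm : 0 < Real.sqrt m := Real.sqrt_pos.mpr hm
  have hsm1 : Real.sqrt m ≤ Real.sqrt (m + 1) := Real.sqrt_le_sqrt (by linarith)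
  have hsum : 0 < Real.sqrt (m + 1) + Real.sqrt m := by linarith
  have hprod : (Real.sqrt (m + 1) - Real.sqrt m) * (Real.sqrt (m + 1) + Real.sqrt m) = 1 := by
    have e1 : Real.sqrt (m + 1) * Real.sqrt (m + 1) = m + 1 := Real.mul_self_sqrt (by linarith)
    have e2 : Real.sqrt m * Real.sqrt m = m := Real.mul_self_sqrt hm.le
    nlinarith [e1, e2]
  have hdiff : Real.sqrt (m + 1) - Real.sqrt m = 1 / (Real.sqrt (m + 1) + Real.sqrt m) := by
    field_simp; linarith [hprod]
  rw [hdiff, mul_one_div, div_le_div_iff₀ hsum hsm]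
  nlinarith

/-- **THE TELESCOPED WINDOW WEIGHT**: `S_{s,j} = Σ_{l<j} √(s∕(s+l+1)) ≥ 2√s(√(s+j+1) − √(s+1))` for `s > 0` (each summand `= √s∕√(s+l+1) ≥ 2√s(√(s+l+2) − √(s+l+1))`,
then telescope) — the integral comparison without integrals; `S_{s,k}∕k ≥ 2√s∕(√(s+k+1) + √(s+1))`. [folklore] -/
theorem readWindow_ge_telescope {s : ℝ} (hs : 0 < s) (j : ℕ) :
    2 * Real.sqrt s * (Real.sqrt (s + j + 1) - Real.sqrt (s + 1)) ≤ ∑ l ∈ range j, Real.sqrt (s / (s + l + 1)) := by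
  induction j with
  | zero => simp
  | succ j ih =>
    rw [sum_range_succ]
    have hm : 0 < s + j + 1 := by positivity
    have hstep := two_mul_sub_sqrt_le_inv_sqrt hm
    have hterm : Real.sqrt (s / (s + j + 1)) = Real.sqrt s * (1 / Real.sqrt (s + j + 1)) := by
      rw [Real.sqrt_div hs.le, mul_one_div]
    have h2 : 2 * Real.sqrt s * (Real.sqrt (s + j + 1 + 1) - Real.sqrt (s + j + 1)) ≤ Real.sqrt (s / (s + j + 1)) := by
      rw [hterm]
      have := mul_le_mul_of_nonneg_left hstep (Real.sqrt_nonneg s)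
      linarith
    push_cast
    rw [show s + ((j : ℝ) + 1) + 1 = s + j + 1 + 1 by ring]
    linarith

/-- The λ-recursion of the dual chain on a tower of ratio `≥ 6`, at the extreme transport `s = 49∕120 ≥ √(1∕6)`, small loads `x ≤ 9∕20`. [folklore] -/
theorem step_poly_low {x u : ℝ} (hx : 0 ≤ x) (hx1 : x ≤ 9 / 20) (hu : 0 ≤ u) (hu1 : u ≤ 13 / 15 * (1 / 2 - 7 / 10 * x)) :
    4 * u * (49 / 120) * (1 + x / 4) + x * (1 + 8 * (49 / 120) * u) ≤ 4 * (x + u) * (1 - x * (3 / 4 + 8 * (49 / 120) * u)) := by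
  nlinarith [mul_nonneg hx hu, mul_nonneg hx (sub_nonneg.mpr hx1), mul_nonneg hu (sub_nonneg.mpr hu1),
    mul_nonneg hx (sub_nonneg.mpr hu1), mul_nonneg hu (sub_nonneg.mpr hx1),
    mul_nonneg (mul_nonneg hx hu) (sub_nonneg.mpr hu1), mul_nonneg (mul_nonneg hx hx) (sub_nonneg.mpr hu1),
    mul_nonneg (mul_nonneg hu hu) (sub_nonneg.mpr hx1), mul_nonneg (mul_nonneg hx hu) (sub_nonneg.mpr hx1)]

/-- … and large loads `9∕20 ≤ x ≤ 71∕100`. [folklore] -/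
theorem step_poly_high {x u : ℝ} (hx : 9 / 20 ≤ x) (hx1 : x ≤ 71 / 100) (hu : 0 ≤ u) (hu1 : u ≤ 13 / 15 * (1 / 2 - 7 / 10 * x)) :
    4 * u * (49 / 120) * (1 + x / 4) + x * (1 + 8 * (49 / 120) * u) ≤ 4 * (x + u) * (1 - x * (3 / 4 + 8 * (49 / 120) * u)) := by
  have hx0 : 0 ≤ x := by linarith
  have hx' : 0 ≤ x - 9 / 20 := by linarith
  nlinarith [mul_nonneg hx0 hu, mul_nonneg hx' (sub_nonneg.mpr hx1), mul_nonneg hu (sub_nonneg.mpr hu1),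
    mul_nonneg hx' (sub_nonneg.mpr hu1), mul_nonneg hu (sub_nonneg.mpr hx1), mul_nonneg hx0 (sub_nonneg.mpr hu1),
    mul_nonneg (mul_nonneg hx0 hu) (sub_nonneg.mpr hu1), mul_nonneg (mul_nonneg hx0 hx') (sub_nonneg.mpr hu1),
    mul_nonneg (mul_nonneg hu hu) (sub_nonneg.mpr hx1), mul_nonneg (mul_nonneg hx0 hu) (sub_nonneg.mpr hx1)]

/-- The λ-recursion inequality on the whole region `0 ≤ x ≤ 71∕100`, `0 ≤ u ≤ (13∕15)(1∕2 − 7x∕10)` (margin `≥ 0.10(x+u)`). [folklore] -/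
theorem step_poly {x u : ℝ} (hx : 0 ≤ x) (hx1 : x ≤ 71 / 100) (hu : 0 ≤ u) (hu1 : u ≤ 13 / 15 * (1 / 2 - 7 / 10 * x)) :
    4 * u * (49 / 120) * (1 + x / 4) + x * (1 + 8 * (49 / 120) * u) ≤ 4 * (x + u) * (1 - x * (3 / 4 + 8 * (49 / 120) * u)) := by
  rcases le_or_gt x (9 / 20) with h | h
  · exact step_poly_low hx h hu hu1
  · exact step_poly_high h.le hx1 hu hu1

/-- The chain condition on the same region: `x(3∕4 + 8·(49∕120)·u) < 1`. [folklore] -/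
theorem cond_poly {x u : ℝ} (hx : 0 ≤ x) (hx1 : x ≤ 71 / 100) (_hu : 0 ≤ u) (hu1 : u ≤ 13 / 15 * (1 / 2 - 7 / 10 * x)) :
    x * (8 * (49 / 120) * u + 3 / 4) < 1 := by
  nlinarith [mul_nonneg hx (sub_nonneg.mpr hx1), mul_nonneg hx (sub_nonneg.mpr hu1)]

/-! ## §2 The dual chain on a tower of ratio `≥ 6` -/

set_option maxHeartbeats 800000 in
/-- **THE WINDOW BUDGET CLOSES THE DUAL CHAIN ON TOWERS OF RATIO `≥ 6`.**  `A` a finite set of ages `≥ 1` with minimum `m₀` and predecessor map `pred`,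
consecutive ratios `6·pred k ≤ k`; loads `x ≥ 0` obeying the WINDOW BUDGET of (E65a) at every scale `j = k ∈ A`: `Σ_{s∈A} x_s·W_k(s) ≤ 1∕2` (`W_k(s) = S_{s,k}∕k`
for `s ≤ k`, `S_{s,k}∕s` for `s > k`, `S_{s,k} = Σ_{l<k}√(s∕(s+l+1))`) — exactly what (E65b)∕(E65f) offer.  Then there are `μ, λ ≥ 0` on `A` satisfying every
inequality of the dual chain of (E65e) (as demanded by (E65f)): `λ_k = 4Σ_{s≤k} x_s√(s∕k)`, `μ` explicit. [folklore] -/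
theorem dual_chain_of_tower_six {A : Finset ℕ} {x : ℕ → ℝ} {pred : ℕ → ℕ} {m₀ : ℕ}
    (hA1 : ∀ k ∈ A, 1 ≤ k) (hx : ∀ k ∈ A, 0 ≤ x k) (hm₀ : m₀ ∈ A) (hmin : ∀ k ∈ A, m₀ ≤ k)
    (hpred : ∀ k ∈ A, k ≠ m₀ → pred k ∈ A ∧ pred k < k ∧ ∀ k'' ∈ A, k'' < k → k'' ≤ pred k)
    (hsix : ∀ k ∈ A, k ≠ m₀ → 6 * pred k ≤ k)
    (hbud : ∀ k ∈ A, ∑ s ∈ A, x s * (if s ≤ k then (∑ l ∈ range k, Real.sqrt ((s : ℝ) / ((s : ℝ) + l + 1))) / k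
        else (∑ l ∈ range k, Real.sqrt ((s : ℝ) / ((s : ℝ) + l + 1))) / s) ≤ 1 / 2) :
    ∃ μ lam : ℕ → ℝ, (∀ k ∈ A, 0 ≤ μ k) ∧ (∀ k ∈ A, 0 ≤ lam k) ∧
      3 / 4 * x m₀ ≤ μ m₀ * (1 - 3 / 4 * x m₀) ∧ x m₀ ≤ lam m₀ * (1 - 3 / 4 * x m₀) ∧
      (∀ k ∈ A, k ≠ m₀ →
        x k * (min (4 * (pred k : ℝ) * k / ((k : ℝ) + pred k) ^ 2 * μ (pred k)) (2 * lam (pred k) * ((pred k : ℝ) / k)) + 3 / 4) < 1) ∧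
      (∀ k ∈ A, k ≠ m₀ →
        min (4 * (pred k : ℝ) * k / ((k : ℝ) + pred k) ^ 2 * μ (pred k)) (2 * lam (pred k) * ((pred k : ℝ) / k)) * (1 + x k) + 3 / 4 * x k ≤
          μ k * (1 - x k * (3 / 4 + min (4 * (pred k : ℝ) * k / ((k : ℝ) + pred k) ^ 2 * μ (pred k)) (2 * lam (pred k) * ((pred k : ℝ) / k))))) ∧
      (∀ k ∈ A, k ≠ m₀ →
        lam (pred k) * ((pred k : ℝ) / k) * (1 + x k / 4) +
            x k * (1 + min (4 * (pred k : ℝ) * k / ((k : ℝ) + pred k) ^ 2 * μ (pred k)) (2 * lam (pred k) * ((pred k : ℝ) / k))) ≤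
          lam k * (1 - x k * (3 / 4 + min (4 * (pred k : ℝ) * k / ((k : ℝ) + pred k) ^ 2 * μ (pred k)) (2 * lam (pred k) * ((pred k : ℝ) / k))))) := by
  have hhalf : (7 : ℝ) / 10 ≤ Real.sqrt (1 / 2) := by
    rw [show (7 : ℝ) / 10 = Real.sqrt ((7 / 10) ^ 2) by rw [Real.sqrt_sq (by norm_num)]]
    exact Real.sqrt_le_sqrt (by norm_num)
  have hhalf' : (50 : ℝ) / 71 ≤ Real.sqrt (1 / 2) := by
    rw [show (50 : ℝ) / 71 = Real.sqrt ((50 / 71) ^ 2) by rw [Real.sqrt_sq (by norm_num)]]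
    exact Real.sqrt_le_sqrt (by norm_num)
  have hdiag : ∀ k : ℕ, 1 ≤ k → Real.sqrt ((k : ℝ) / ((k : ℝ) + k)) = Real.sqrt (1 / 2) := by
    intro k hk
    have hkr : (0 : ℝ) < k := by exact_mod_cast hk
    congr 1; field_simp; ring
  have hW0 : ∀ k s : ℕ, 0 ≤ (if s ≤ k then (∑ l ∈ range k, Real.sqrt ((s : ℝ) / ((s : ℝ) + l + 1))) / k
      else (∑ l ∈ range k, Real.sqrt ((s : ℝ) / ((s : ℝ) + l + 1))) / s) := fun k s => by
    have := readWindow_nonneg s k; split_ifs <;> positivity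
  have hown : ∀ k ∈ A, x k * Real.sqrt (1 / 2) ≤ x k * ((∑ l ∈ range k, Real.sqrt ((k : ℝ) / ((k : ℝ) + l + 1))) / k) := by
    intro k hk
    have hkr : (0 : ℝ) < k := by exact_mod_cast hA1 k hk
    refine mul_le_mul_of_nonneg_left ?_ (hx k hk)
    rw [← hdiag k (hA1 k hk), le_div_iff₀ hkr, mul_comm]
    exact mul_sqrt_le_readWindow k k
  have hcap : ∀ k ∈ A, x k ≤ 71 / 100 := by
    intro k hk
    have hb := hbud k hk
    have hsingle := single_le_sum (f := fun s => x s * (if s ≤ k then (∑ l ∈ range k, Real.sqrt ((s : ℝ) / ((s : ℝ) + l + 1))) / k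
        else (∑ l ∈ range k, Real.sqrt ((s : ℝ) / ((s : ℝ) + l + 1))) / s)) (fun s hs => mul_nonneg (hx s hs) (hW0 k s)) hk
    have h0 : x k * ((∑ l ∈ range k, Real.sqrt ((k : ℝ) / ((k : ℝ) + l + 1))) / k) ≤ 1 / 2 := by
      have := hsingle.trans hb; simpa only [le_refl, if_true] using this
    have h1 : x k * Real.sqrt (1 / 2) ≤ 1 / 2 := (hown k hk).trans h0
    have h2 : x k * (50 / 71) ≤ x k * Real.sqrt (1 / 2) := mul_le_mul_of_nonneg_left hhalf' (hx k hk)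
    linarith
  obtain ⟨Z, hZ_def⟩ : ∃ Z : ℕ → ℝ, Z = fun k => ∑ s ∈ A.filter (fun s => s ≤ k), x s * Real.sqrt ((s : ℝ) / k) := ⟨_, rfl⟩
  have hZ0 : ∀ k, 0 ≤ Z k := fun k => by
    rw [hZ_def]; exact sum_nonneg fun s hs => mul_nonneg (hx s (mem_filter.mp hs).1) (Real.sqrt_nonneg _)
  obtain ⟨lam, hlam_def⟩ : ∃ lam : ℕ → ℝ, lam = fun k => 4 * Z k := ⟨_, rfl⟩
  obtain ⟨eb, heb_def⟩ : ∃ eb : ℕ → ℝ, eb = fun k => 2 * lam (pred k) * ((pred k : ℝ) / k) := ⟨_, rfl⟩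
  obtain ⟨μ, hμ_def⟩ : ∃ μ : ℕ → ℝ, μ = fun k => if k = m₀ then (3 / 4 * x m₀) / (1 - 3 / 4 * x m₀)
      else (eb k * (1 + x k) + 3 / 4 * x k) / (1 - x k * (3 / 4 + eb k)) := ⟨_, rfl⟩
  have hlam0 : ∀ k, 0 ≤ lam k := fun k => by rw [hlam_def]; exact mul_nonneg (by norm_num) (hZ0 k)
  have heb0 : ∀ k, 0 ≤ eb k := fun k => by rw [heb_def]; have := hlam0 (pred k); positivity
  have hZm : Z m₀ = x m₀ := by
    have hset : A.filter (fun s => s ≤ m₀) = {m₀} := by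
      ext s; simp only [mem_filter, mem_singleton]
      constructor
      · rintro ⟨hs, hsm⟩; exact le_antisymm hsm (hmin s hs)
      · rintro rfl; exact ⟨hm₀, le_rfl⟩
    have hm1 : (0 : ℝ) < m₀ := by exact_mod_cast hA1 m₀ hm₀
    rw [hZ_def]; simp only [hset, sum_singleton]
    rw [div_self hm1.ne', Real.sqrt_one, mul_one]
  have hsplit : ∀ k ∈ A, k ≠ m₀ →
      Z k = x k + Real.sqrt ((pred k : ℝ) / k) * Z (pred k) ∧
      A.filter (fun s => s < k) = A.filter (fun s => s ≤ pred k) := by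
    intro k hk hne
    obtain ⟨hpA, hplt, hpmax⟩ := hpred k hk hne
    have hkr : (0 : ℝ) < k := by exact_mod_cast hA1 k hk
    have hpr : (0 : ℝ) < pred k := by exact_mod_cast hA1 _ hpA
    have hset1 : A.filter (fun s => s < k) = A.filter (fun s => s ≤ pred k) := by
      ext s; simp only [mem_filter]
      constructor
      · rintro ⟨hs, hsk⟩; exact ⟨hs, hpmax s hs hsk⟩
      · rintro ⟨hs, hsp⟩; exact ⟨hs, lt_of_le_of_lt hsp hplt⟩
    have hset2 : A.filter (fun s => s ≤ k) = insert k (A.filter (fun s => s ≤ pred k)) := by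
      ext s; simp only [mem_filter, mem_insert]
      constructor
      · rintro ⟨hs, hsk⟩
        rcases lt_or_eq_of_le hsk with h | h
        · exact Or.inr ⟨hs, hpmax s hs h⟩
        · exact Or.inl h
      · rintro (rfl | ⟨hs, hsp⟩)
        · exact ⟨hk, le_rfl⟩
        · exact ⟨hs, hsp.trans hplt.le⟩
    have hnot : k ∉ A.filter (fun s => s ≤ pred k) := by
      simp only [mem_filter, not_and, not_le]; exact fun _ => hplt
    refine ⟨?_, hset1⟩
    rw [hZ_def]; simp only [hset2, sum_insert hnot]
    rw [div_self hkr.ne', Real.sqrt_one, mul_one, mul_sum]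
    congr 1
    refine sum_congr rfl fun s hs => ?_
    have hs0 : (0 : ℝ) ≤ s := Nat.cast_nonneg s
    rw [show (s : ℝ) / k = (pred k : ℝ) / k * ((s : ℝ) / pred k) by field_simp,
      Real.sqrt_mul (by positivity)]
    ring
  have hstep : ∀ k ∈ A, k ≠ m₀ →
      x k * (eb k + 3 / 4) < 1 ∧
      lam (pred k) * ((pred k : ℝ) / k) * (1 + x k / 4) + x k * (1 + eb k) ≤ lam k * (1 - x k * (3 / 4 + eb k)) := by
    intro k hk hkm
    obtain ⟨hpA, hplt, hpmax⟩ := hpred k hk hkm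
    have hkr : (0 : ℝ) < k := by exact_mod_cast hA1 k hk
    have hpr : (0 : ℝ) < pred k := by exact_mod_cast hA1 _ hpA
    have hxk := hx k hk
    obtain ⟨hZk, hset1⟩ := hsplit k hk hkm
    have hsix' : 6 * (pred k : ℝ) ≤ k := by exact_mod_cast hsix k hk hkm
    have hp1 : (1 : ℝ) ≤ pred k := by exact_mod_cast hA1 _ hpA
    obtain ⟨ρ, hρ_def⟩ : ∃ ρ : ℝ, ρ = 2 * Real.sqrt (pred k : ℝ) / (Real.sqrt ((pred k : ℝ) + k + 1) + Real.sqrt ((pred k : ℝ) + 1)) := ⟨_, rfl⟩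
    have hden : 0 < Real.sqrt ((pred k : ℝ) + k + 1) + Real.sqrt ((pred k : ℝ) + 1) := by positivity
    have hρ0 : 0 ≤ ρ := by rw [hρ_def]; positivity
    have hb2 : x k * Real.sqrt (1 / 2) + ρ * Z (pred k) ≤ 1 / 2 := by
      have hb := hbud k hk
      have hset2 : A.filter (fun s => s ≤ k) = insert k (A.filter (fun s => s ≤ pred k)) := by
        ext s; simp only [mem_filter, Finset.mem_insert]
        constructor
        · rintro ⟨hs, hsk⟩
          rcases lt_or_eq_of_le hsk with h1 | h1
          · exact Or.inr ⟨hs, hpmax s hs h1⟩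
          · exact Or.inl h1
        · rintro (rfl | ⟨hs, hsp⟩)
          · exact ⟨hk, le_rfl⟩
          · exact ⟨hs, hsp.trans hplt.le⟩
      have hnot : k ∉ A.filter (fun s => s ≤ pred k) := by
        simp only [mem_filter, not_and, not_le]; exact fun _ => hplt
      have hdrop : ∑ s ∈ A.filter (fun s => s ≤ k), x s * ((∑ l ∈ range k, Real.sqrt ((s : ℝ) / ((s : ℝ) + l + 1))) / k) ≤
          ∑ s ∈ A, x s * (if s ≤ k then (∑ l ∈ range k, Real.sqrt ((s : ℝ) / ((s : ℝ) + l + 1))) / k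
            else (∑ l ∈ range k, Real.sqrt ((s : ℝ) / ((s : ℝ) + l + 1))) / s) := by
        calc ∑ s ∈ A.filter (fun s => s ≤ k), x s * ((∑ l ∈ range k, Real.sqrt ((s : ℝ) / ((s : ℝ) + l + 1))) / k)
            = ∑ s ∈ A.filter (fun s => s ≤ k), x s * (if s ≤ k then (∑ l ∈ range k, Real.sqrt ((s : ℝ) / ((s : ℝ) + l + 1))) / k
                else (∑ l ∈ range k, Real.sqrt ((s : ℝ) / ((s : ℝ) + l + 1))) / s) :=
              sum_congr rfl fun s hs => by rw [if_pos (mem_filter.mp hs).2]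
          _ ≤ _ := sum_le_sum_of_subset_of_nonneg (filter_subset _ A) fun s hs _ => mul_nonneg (hx s hs) (hW0 k s)
      rw [hset2, sum_insert hnot] at hdrop
      have hyoung : ρ * Z (pred k) ≤ ∑ s ∈ A.filter (fun s => s ≤ pred k), x s * ((∑ l ∈ range k, Real.sqrt ((s : ℝ) / ((s : ℝ) + l + 1))) / k) := by
        rw [hZ_def]; simp only; rw [mul_sum]
        refine sum_le_sum fun s hs => ?_
        have hsA := (mem_filter.mp hs).1; have hsp : s ≤ pred k := (mem_filter.mp hs).2
        have hs1 : (0 : ℝ) < s := by exact_mod_cast hA1 s hsA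
        have hsp' : (s : ℝ) ≤ pred k := by exact_mod_cast hsp
        have htel := readWindow_ge_telescope hs1 k
        have hdiff : Real.sqrt ((s : ℝ) + k + 1) - Real.sqrt ((s : ℝ) + 1) = k / (Real.sqrt ((s : ℝ) + k + 1) + Real.sqrt ((s : ℝ) + 1)) := by
          have e1 : Real.sqrt ((s : ℝ) + k + 1) * Real.sqrt ((s : ℝ) + k + 1) = (s : ℝ) + k + 1 := Real.mul_self_sqrt (by positivity)
          have e2 : Real.sqrt ((s : ℝ) + 1) * Real.sqrt ((s : ℝ) + 1) = (s : ℝ) + 1 := Real.mul_self_sqrt (by positivity)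
          have hpos : 0 < Real.sqrt ((s : ℝ) + k + 1) + Real.sqrt ((s : ℝ) + 1) := by positivity
          field_simp; nlinarith [e1, e2]
        have hdens : Real.sqrt ((s : ℝ) + k + 1) + Real.sqrt ((s : ℝ) + 1) ≤ Real.sqrt ((pred k : ℝ) + k + 1) + Real.sqrt ((pred k : ℝ) + 1) :=
          add_le_add (Real.sqrt_le_sqrt (by linarith)) (Real.sqrt_le_sqrt (by linarith))
        have hposs : 0 < Real.sqrt ((s : ℝ) + k + 1) + Real.sqrt ((s : ℝ) + 1) := by positivity
        have hW : 2 * Real.sqrt (s : ℝ) / (Real.sqrt ((pred k : ℝ) + k + 1) + Real.sqrt ((pred k : ℝ) + 1)) ≤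
            (∑ l ∈ range k, Real.sqrt ((s : ℝ) / ((s : ℝ) + l + 1))) / k := by
          rw [le_div_iff₀ hkr]
          calc 2 * Real.sqrt (s : ℝ) / (Real.sqrt ((pred k : ℝ) + k + 1) + Real.sqrt ((pred k : ℝ) + 1)) * k
              ≤ 2 * Real.sqrt (s : ℝ) / (Real.sqrt ((s : ℝ) + k + 1) + Real.sqrt ((s : ℝ) + 1)) * k := by
                apply mul_le_mul_of_nonneg_right _ hkr.le
                exact div_le_div_of_nonneg_left (by positivity) hposs hdens
            _ = 2 * Real.sqrt (s : ℝ) * (Real.sqrt ((s : ℝ) + k + 1) - Real.sqrt ((s : ℝ) + 1)) := by rw [hdiff]; field_simp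
            _ ≤ ∑ l ∈ range k, Real.sqrt ((s : ℝ) / ((s : ℝ) + l + 1)) := htel
        have hsq : Real.sqrt (s : ℝ) = Real.sqrt (pred k : ℝ) * Real.sqrt ((s : ℝ) / pred k) := by
          rw [← Real.sqrt_mul (by positivity)]; congr 1; field_simp
        calc ρ * (x s * Real.sqrt ((s : ℝ) / pred k)) = x s * (2 * Real.sqrt (s : ℝ) / (Real.sqrt ((pred k : ℝ) + k + 1) + Real.sqrt ((pred k : ℝ) + 1))) := by
              rw [hρ_def, hsq]; ring
          _ ≤ x s * ((∑ l ∈ range k, Real.sqrt ((s : ℝ) / ((s : ℝ) + l + 1))) / k) := mul_le_mul_of_nonneg_left hW (hx s hsA)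
      have h1 := hown k hk
      linarith [hdrop.trans hb]
    have hsqrtk : 0 < Real.sqrt (k : ℝ) := Real.sqrt_pos.mpr hkr
    have hA' : Real.sqrt ((pred k : ℝ) + k + 1) ≤ 52 / 45 * Real.sqrt (k : ℝ) := by
      rw [show (52 : ℝ) / 45 * Real.sqrt (k : ℝ) = Real.sqrt ((52 / 45) ^ 2 * k) by
        rw [Real.sqrt_mul (by norm_num), Real.sqrt_sq (by norm_num)]]
      exact Real.sqrt_le_sqrt (by nlinarith)
    have hB' : Real.sqrt ((pred k : ℝ) + 1) ≤ 26 / 45 * Real.sqrt (k : ℝ) := by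
      rw [show (26 : ℝ) / 45 * Real.sqrt (k : ℝ) = Real.sqrt ((26 / 45) ^ 2 * k) by
        rw [Real.sqrt_mul (by norm_num), Real.sqrt_sq (by norm_num)]]
      exact Real.sqrt_le_sqrt (by nlinarith)
    have hu1 : Real.sqrt ((pred k : ℝ) / k) * Z (pred k) ≤ 13 / 15 * (1 / 2 - 7 / 10 * x k) := by
      have hconv : Real.sqrt ((pred k : ℝ) / k) = (Real.sqrt ((pred k : ℝ) + k + 1) + Real.sqrt ((pred k : ℝ) + 1)) / (2 * Real.sqrt (k : ℝ)) * ρ := by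
        rw [hρ_def, Real.sqrt_div (by positivity)]
        field_simp
      have hfac : (Real.sqrt ((pred k : ℝ) + k + 1) + Real.sqrt ((pred k : ℝ) + 1)) / (2 * Real.sqrt (k : ℝ)) ≤ 13 / 15 := by
        rw [div_le_iff₀ (by positivity)]; linarith
      have hρZ : ρ * Z (pred k) ≤ 1 / 2 - 7 / 10 * x k := by
        have h3 : x k * (7 / 10) ≤ x k * Real.sqrt (1 / 2) := mul_le_mul_of_nonneg_left hhalf hxk
        linarith
      have hρZ0 : 0 ≤ ρ * Z (pred k) := mul_nonneg hρ0 (hZ0 _)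
      calc Real.sqrt ((pred k : ℝ) / k) * Z (pred k)
          = (Real.sqrt ((pred k : ℝ) + k + 1) + Real.sqrt ((pred k : ℝ) + 1)) / (2 * Real.sqrt (k : ℝ)) * (ρ * Z (pred k)) := by
            rw [hconv]; ring
        _ ≤ 13 / 15 * (ρ * Z (pred k)) := mul_le_mul_of_nonneg_right hfac hρZ0
        _ ≤ 13 / 15 * (1 / 2 - 7 / 10 * x k) := mul_le_mul_of_nonneg_left hρZ (by norm_num)
    have hs19 : Real.sqrt ((pred k : ℝ) / k) ≤ 49 / 120 := by
      rw [show (49 : ℝ) / 120 = Real.sqrt ((49 / 120) ^ 2) by rw [Real.sqrt_sq (by norm_num)]]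
      apply Real.sqrt_le_sqrt
      rw [div_le_iff₀ hkr]; nlinarith
    have hs0 : 0 ≤ Real.sqrt ((pred k : ℝ) / k) := Real.sqrt_nonneg _
    have hu0 : 0 ≤ Real.sqrt ((pred k : ℝ) / k) * Z (pred k) := mul_nonneg hs0 (hZ0 _)
    have hss : Real.sqrt ((pred k : ℝ) / k) * Real.sqrt ((pred k : ℝ) / k) = (pred k : ℝ) / k := Real.mul_self_sqrt (by positivity)
    have hebk : eb k = 8 * Real.sqrt ((pred k : ℝ) / k) * (Real.sqrt ((pred k : ℝ) / k) * Z (pred k)) := by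
      rw [heb_def, hlam_def]; simp only
      linear_combination (-8 * Z (pred k)) * hss
    have hlamp : lam (pred k) * ((pred k : ℝ) / k) = 4 * Real.sqrt ((pred k : ℝ) / k) * (Real.sqrt ((pred k : ℝ) / k) * Z (pred k)) := by
      rw [hlam_def]; simp only
      linear_combination (-4 * Z (pred k)) * hss
    have hlamk : lam k = 4 * (x k + Real.sqrt ((pred k : ℝ) / k) * Z (pred k)) := by
      rw [hlam_def]; simp only; rw [hZk]
    set sσ : ℝ := Real.sqrt ((pred k : ℝ) / k) with hsσ
    set u : ℝ := sσ * Z (pred k) with hu_def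
    have hebu : eb k ≤ 8 * (49 / 120) * u := by rw [hebk]; exact mul_le_mul_of_nonneg_right (by linarith) hu0
    constructor
    · -- the condition
      have hc := cond_poly hxk (hcap k hk) hu0 hu1
      nlinarith [mul_le_mul_of_nonneg_left hebu hxk]
    · -- the λ-recursion: reduce to step_poly at s = 19/60 by monotonicity in s
      rw [hlamp, hlamk, hebk]
      have hP := step_poly hxk (hcap k hk) hu0 hu1
      have hx4 : 0 ≤ 1 + x k / 4 := by linarith
      have hmono1 : 4 * sσ * u * (1 + x k / 4) ≤ 4 * u * (49 / 120) * (1 + x k / 4) := by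
        have := mul_le_mul_of_nonneg_right (mul_le_mul_of_nonneg_right hs19 hu0) hx4; nlinarith
      have hmono2 : x k * (1 + 8 * sσ * u) ≤ x k * (1 + 8 * (49 / 120) * u) := by
        apply mul_le_mul_of_nonneg_left _ hxk; nlinarith [mul_le_mul_of_nonneg_right hs19 hu0]
      have hmono3 : 4 * (x k + u) * (1 - x k * (3 / 4 + 8 * (49 / 120) * u)) ≤ 4 * (x k + u) * (1 - x k * (3 / 4 + 8 * sσ * u)) := by
        apply mul_le_mul_of_nonneg_left _ (by positivity)
        nlinarith [mul_le_mul_of_nonneg_right hs19 hu0]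
      linarith
  have hμm : μ m₀ = (3 / 4 * x m₀) / (1 - 3 / 4 * x m₀) := by rw [hμ_def]; exact if_pos rfl
  have hμk : ∀ k, k ≠ m₀ → μ k = (eb k * (1 + x k) + 3 / 4 * x k) / (1 - x k * (3 / 4 + eb k)) := fun k hk => by
    rw [hμ_def]; exact if_neg hk
  have hμ0 : ∀ k ∈ A, 0 ≤ μ k := by
    intro k hk
    by_cases hkm : k = m₀
    · have h1 := hcap m₀ hm₀
      have h2 := hx m₀ hm₀
      have e : μ k = (3 / 4 * x m₀) / (1 - 3 / 4 * x m₀) := by rw [hkm]; exact hμm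
      have hnum : 0 ≤ 3 / 4 * x m₀ := mul_nonneg (by norm_num) h2
      have hden : 0 ≤ 1 - 3 / 4 * x m₀ := by
        have : 3 / 4 * x m₀ ≤ 3 / 4 * (71 / 100) := mul_le_mul_of_nonneg_left h1 (by norm_num)
        exact sub_nonneg.mpr (this.trans (by norm_num))
      rw [e]; exact div_nonneg hnum hden
    · have h1 := heb0 k
      have h2 := hx k hk
      have h3 := (hstep k hk hkm).1
      have h4 : 0 ≤ eb k * (1 + x k) := mul_nonneg h1 (add_nonneg zero_le_one h2)
      have h5 : 0 ≤ eb k * (1 + x k) + 3 / 4 * x k := add_nonneg h4 (mul_nonneg (by norm_num) h2)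
      have h6 : x k * (3 / 4 + eb k) = x k * (eb k + 3 / 4) := by ring
      have h7 : 0 ≤ 1 - x k * (3 / 4 + eb k) := by rw [h6]; exact sub_nonneg.mpr h3.le
      rw [hμk k hkm]; exact div_nonneg h5 h7
  refine ⟨μ, lam, hμ0, fun k _ => hlam0 k, ?_, ?_, ?_, ?_, ?_⟩
  · -- base μ
    have := hcap m₀ hm₀
    rw [hμm, div_mul_cancel₀ _ (by linarith)]
  · -- base λ
    have hl : lam m₀ = 4 * x m₀ := by rw [hlam_def]; simp only; rw [hZm]
    rw [hl]
    have := hcap m₀ hm₀; have := hx m₀ hm₀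
    nlinarith
  · -- condition, with e ≤ eb
    intro k hk hkm
    have h1 := (hstep k hk hkm).1
    have hmin' : min (4 * (pred k : ℝ) * k / ((k : ℝ) + pred k) ^ 2 * μ (pred k)) (2 * lam (pred k) * ((pred k : ℝ) / k)) ≤ eb k := by
      rw [heb_def]; exact min_le_right _ _
    nlinarith [mul_le_mul_of_nonneg_left hmin' (hx k hk)]
  · -- μ-recursion, by the definition of μ at eb and monotonicity in e
    intro k hk hkm
    have h1 := (hstep k hk hkm).1
    have hxk := hx k hk
    have hmin' : min (4 * (pred k : ℝ) * k / ((k : ℝ) + pred k) ^ 2 * μ (pred k)) (2 * lam (pred k) * ((pred k : ℝ) / k)) ≤ eb k := by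
      rw [heb_def]; exact min_le_right _ _
    set e := min (4 * (pred k : ℝ) * k / ((k : ℝ) + pred k) ^ 2 * μ (pred k)) (2 * lam (pred k) * ((pred k : ℝ) / k)) with he
    have hden : 0 < 1 - x k * (3 / 4 + eb k) := by have := h1; nlinarith [hxk, heb0 k]
    have hμk' : μ k * (1 - x k * (3 / 4 + eb k)) = eb k * (1 + x k) + 3 / 4 * x k := by
      rw [hμk k hkm, div_mul_cancel₀ _ hden.ne']
    have hμ0' : 0 ≤ μ k := hμ0 k hk
    have h2 : e * (1 + x k) ≤ eb k * (1 + x k) := mul_le_mul_of_nonneg_right hmin' (by linarith)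
    have h3 : μ k * (1 - x k * (3 / 4 + eb k)) ≤ μ k * (1 - x k * (3 / 4 + e)) :=
      mul_le_mul_of_nonneg_left (by nlinarith [mul_le_mul_of_nonneg_left hmin' hxk]) hμ0'
    linarith
  · -- λ-recursion, monotone in e
    intro k hk hkm
    have h2 := (hstep k hk hkm).2
    have hxk := hx k hk
    have hmin' : min (4 * (pred k : ℝ) * k / ((k : ℝ) + pred k) ^ 2 * μ (pred k)) (2 * lam (pred k) * ((pred k : ℝ) / k)) ≤ eb k := by
      rw [heb_def]; exact min_le_right _ _
    set e := min (4 * (pred k : ℝ) * k / ((k : ℝ) + pred k) ^ 2 * μ (pred k)) (2 * lam (pred k) * ((pred k : ℝ) / k)) with he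
    have h3 : x k * (1 + e) ≤ x k * (1 + eb k) := mul_le_mul_of_nonneg_left (by linarith) hxk
    have h4 : lam k * (1 - x k * (3 / 4 + eb k)) ≤ lam k * (1 - x k * (3 / 4 + e)) :=
      mul_le_mul_of_nonneg_left (by nlinarith [mul_le_mul_of_nonneg_left hmin' hxk]) (hlam0 k)
    linarith

end Summit.QuantumFields.BalabanUV.Beta.EriceRemainderEnclosureHistoryAutonomyComparisonTowerChainSix

end
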